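import Literature.MathematicalPhysics.QuantumFieldTheory.BalabanImbrieJaffe1984to88.BIJ88Sect4Statements

/-!
# `BalabanImbrieJaffe1984to88.BIJ88InductiveForm41` — T. Bałaban, J. Imbrie, A. Jaffe, *Effective action and cluster
properties of the abelian Higgs model*, Commun. Math. Phys. **114** (1988) 257–315 [BalabanImbrieJaffe1988]: the
INDUCTIVE FORM (4.1) p. 273 of the k-step density (and its first-step model (3.44) p. 273), TYPED as a function of the fields

statement-level skeleton of published theorems with citation tags; proofs where landed; nothing here is a claim about the Yang–Mills mass gap

PDF held: `paper:balaban1988-cmp114-bij-abelian-higgs-effective-action` (journal page = PDF page + 256).  Renders read as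
images (poppler ×3): PDF pp. 17–19 (journal 273–275).

CITATION HEADER (lean-in-tree rule).  Part of the lit-balaban TYPED SKELETON (HOME `run/shared/lean/pub/lit-balaban/`; rows
`C2.Eq4.1` and `C2.Eq3.44` of `HOME/lit-balaban-r18/ROWS-C2.md`; unit `lit-balaban-r18`, gen 2).  WHAT IS REPRODUCED, verbatim,
p. 273 [PDF 17]: *"Our k-step density has the form
ρ_k(u,φ) = Σ_{{X_ω}} ∫ Π_{j=0}^{k−1} [𝒟u^{(j)}|_{Λ₁₀^{(j)c*}}] ρ′_k(u,φ,{X_ω},{u^{(j)}}),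
ρ′_k(u,φ,{X_ω},{u^{(j)}}) = χ_{k,Λ₀^{(k−1)′}} Π_ω g_k(X_ω) Π_σ F_{k,loc}(X_σ) Π_{j=0}^{k−1} [Z^{(j)}_{Λ₁₀^{(j)c*c}} Z^{(j)}_{Λ₁₀^{(j)}}(u_k)]
  × exp[−½⟨Λ₅^{(k−1)′**}f^{(k)}, σ_{k,loc}Λ₅^{(k−1)′**}f^{(k)}⟩ − ½⟨Λ₈^{(k−1)′}φ, Δ_{k,loc}(u_k)Λ₈^{(k−1)′}φ⟩ − 𝒫_{k,loc}(Λ₈^{(k−1)})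
  − ℰ_k]. (4.1)"*; p. 274 [PDF 18]: *"If we integrate this density over the u, φ variables, we obtain our original unnormalized
expectation [F]. The measure du^{(j)} is the normalized measure on U(1), ∫du^{(j)} = 1. … Each X_ω is a union of r(e_{k−1})-cubes
of the L⁻¹-lattice, and the X_ω's do not overlap. … The factors g_k(X_ω) represent the effect of large fields or irrelevant
interactions from all previous steps. The factors g_k(X_ω) depend on u^{(j)}, 0 ≦ j ≦ k−1 and on u, φ. The external gauge field
appearing throughout the initial density is u_k. It depends on all the u^{(j)}"*; p. 273 on (3.44): *"We have described this
expression in some detail, as it is the model for our starting point for the general step."*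
TYPED READING (levels of `Balaban1983to89.Setup`: the η-lattice `T_η`, `η = L^{−k}`, is level `0`; the `L^jη`-lattice of the
fluctuation field `u^{(j)}` is level `j`; the unit lattice `T₁^{(k)}` of the fields `u, φ` is level `k`).  One TERM of (4.1) (one
choice of `{X_ω}` with the regions it specifies) is a `Term41 P k`: its DATA are the factors the display multiplies — the index
types of the `X_ω` and `X_σ` with `g_k(X_ω)`, `F_{k,loc}(X_σ)` as functions of `({u^{(j)}}, u, φ)` (p. 274), the characteristic
function `χ_{k,Λ₀^{(k−1)′}}` ((4.5), `BIJ88Sect4Statements.Restr45` is its content), the background `u_k({u^{(j)}}, u)` on the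
η-lattice ((4.2) in `Λ̄₆*`, `BIJ88Sect4Statements.backgroundU`), the normalization factors `Z^{(j)}` ((4.6), numbers) and
`Z^{(j)}(u_k)` ((4.9), functions of the background) — both evaluated in `BIJ88Normalization46` —, the running charge `e_k`, the
regions `Λ₅^{(k−1)′**}` (plaquettes) and `Λ₈^{(k−1)′}` (sites) of the unit lattice with the kernels `σ_{k,loc}` (2.14) and
`Δ_{k,loc}(u_k)` (2.34), the interaction `𝒫_{k,loc}(Λ₈^{(k−1)})` (perturbation expansion, deferred by the paper, p. 275) and the
constant `ℰ_k`; `f^{(k)}(p) = (ie_k)⁻¹ log u(p)` is `BIJ88Sect3Statements.fieldStrength`.  `ρ′_k` is then the DEFINED function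
`rhoPrime` (the display, symbol by symbol), the fluctuation-field integral is over `Π_{j<k} GaugeField P j U1` with the product
of the normalized Haar measures `fieldMeasure` (*"∫du^{(j)} = 1"*; integrating over all bonds of level `j` instead of those in
`Λ₁₀^{(j)c*}` changes nothing for an integrand that ignores the others), `ρ_k` = `rho` = the finite sum over terms of these
integrals, and the sentence *"integrating over u, φ gives [F]"* is the `Prop` `Represents41` against `BIJ88Sect3Statements.bracket`
on the η-lattice.  (3.44) p. 273 is the instance `k = 1` (`rho` at `k = 1`).  Elementary API PROVED: a term vanishes off the
small-field characteristic function (`rhoPrime_eq_zero_of_chi`), `ρ_k` of no terms is `0` (`rho_empty`), additivity in the term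
set (`rho_union`).  NOT HERE: the construction of the regions `Λ_α^{(j)}` and of `g_k`, `F_{k,loc}`, `𝒫_{k,loc}` (Sect. 5, rows
`C2.Eq5.*`, r16), the inductive proof that one more step reproduces the form (C2.Claim@313), any bound.
-/

namespace Literature.MathematicalPhysics.QuantumFieldTheory.BalabanImbrieJaffe1984to88.BIJ88InductiveForm41

open _root_.MeasureTheory
open scoped BigOperators
open Literature.MathematicalPhysics.QuantumFieldTheory.Balaban1983to89
open BIJ88Sect3Statements (U1)

noncomputable section

variable {P : Params} {k : ℕ}

/-- The previous fluctuation fields `{u^{(j)}}_{j=0}^{k−1}`, `u^{(j)}` a `U(1)` gauge field on the `L^jη`-lattice (level `j`).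
[cite: BalabanImbrieJaffe1988, (4.1) p.273] -/
abbrev Prev (P : Params) (k : ℕ) : Type := (j : Fin k) → GaugeField P j U1

/-- `Π_{j=0}^{k−1} 𝒟u^{(j)}`: the product of the normalized Haar measures, p. 274 *"The measure du^{(j)} is the normalized measure
on U(1), ∫du^{(j)} = 1"* (each factor is the tree's product Haar measure `fieldMeasure P j U1`). [cite: BalabanImbrieJaffe1988, (4.1) p.274] -/
def prevMeasure (P : Params) (k : ℕ) : Measure (Prev P k) :=
  Measure.pi fun j : Fin k => fieldMeasure P (j : ℕ) U1

/-- The DATA of one term (one choice of the large-field regions `{X_ω}`) of the inductive representation (4.1), p. 273–275 —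
see the module docstring for the dictionary; every field is an object the display multiplies or a region it sums over.
[cite: BalabanImbrieJaffe1988, (4.1) p.273] -/
structure Term41 (P : Params) (k : ℕ) where
  /-- index type of the large-field regions `X_ω` of the term (p. 274: non-overlapping unions of r(e_{k−1})-cubes) -/
  Ω : Type
  [fintypeΩ : Fintype Ω]
  /-- index type of the observable-support components `X_σ` -/
  Obs : Type
  [fintypeObs : Fintype Obs]
  /-- `g_k(X_ω)`, p. 274: *"depend on u^{(j)}, 0 ≦ j ≦ k−1 and on u, φ"* -/
  g : Ω → Prev P k → (PBond P k → ℂ) → (Balaban1983to89.Site P k → ℂ) → ℝ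
  /-- the localized observable factors `F_{k,loc}(X_σ)` -/
  Floc : Obs → Prev P k → (PBond P k → ℂ) → (Balaban1983to89.Site P k → ℂ) → ℂ
  /-- the characteristic function `χ_{k,Λ₀^{(k−1)′}}` of the restrictions (4.5) (its value on the configuration) -/
  chi : Prev P k → (PBond P k → ℂ) → (Balaban1983to89.Site P k → ℂ) → ℝ
  /-- the background `u_k` on the η-lattice (level 0) as a function of `{u^{(j)}}` and `u` ((4.2) in `Λ̄₆^{(k−1)*}`) -/
  uk : Prev P k → (PBond P k → ℂ) → (PBond P 0 → ℂ)
  /-- the gauge-field normalization factors `Z^{(j)}_{Λ₁₀^{(j)c*c}}`, `j < k` ((4.6): numbers) -/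
  Zv : Fin k → ℝ
  /-- the scalar normalization factors `Z^{(j)}_{Λ₁₀^{(j)}}(u_k)`, `j < k` ((4.9): functions of the background) -/
  Zs : Fin k → (PBond P 0 → ℂ) → ℝ
  /-- the running charge `e_k` of (2.2), in `f^{(k)}(p) = (ie_k)⁻¹ log u(p)` -/
  ek : ℝ
  /-- the plaquettes of `Λ₅^{(k−1)′**}` (unit lattice) -/
  Λ5 : Finset (Plaq P k)
  /-- the kernel of `σ_{k,loc}` ((2.14)) on unit-lattice plaquettes -/
  σloc : Plaq P k → Plaq P k → ℝ
  /-- the sites of `Λ₈^{(k−1)′}` (unit lattice) -/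
  Λ8 : Finset (Balaban1983to89.Site P k)
  /-- the kernel of `Δ_{k,loc}(u_k)` ((2.34)) on unit-lattice sites, a function of the background -/
  Δloc : (PBond P 0 → ℂ) → Balaban1983to89.Site P k → Balaban1983to89.Site P k → ℂ
  /-- the interaction `𝒫_{k,loc}(Λ₈^{(k−1)})` (p. 275: *"given by a perturbation expansion up to some fixed order n̄, which we
  describe in detail in a later paper"*) -/
  Ploc : Prev P k → (PBond P k → ℂ) → (Balaban1983to89.Site P k → ℂ) → ℝ
  /-- the constant `ℰ_k` -/
  calE : ℝ

attribute [instance] Term41.fintypeΩ Term41.fintypeObs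

/-- `f^{(k)}(p) = (ie_k)⁻¹ log u(p)` (p. 274, below (4.2); = (3.26)/(3.15)) as the REAL field strength of the unit-lattice
plaquette variable `u(p)` (`BIJ88Sect3Statements.fieldStrength ∘ plaqVar`, real part — it is real for `|u(p)| = 1`).
[cite: BalabanImbrieJaffe1988, (4.2) p.274] -/
def fStrength (ek : ℝ) (u : PBond P k → ℂ) (p : Plaq P k) : ℝ :=
  (BIJ88Sect3Statements.fieldStrength ek (BIJ88Sect3Statements.plaqVar u p)).re

/-- The gauge-field quadratic form of (4.1), `⟨Λ₅^{(k−1)′**}f^{(k)}, σ_{k,loc}Λ₅^{(k−1)′**}f^{(k)}⟩ =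
Σ_{p,p′ ∈ Λ₅′**} f^{(k)}(p) σ_{k,loc}(p,p′) f^{(k)}(p′)`. [cite: BalabanImbrieJaffe1988, (4.1) p.273] -/
def gaugeForm (T : Term41 P k) (u : PBond P k → ℂ) : ℝ :=
  ∑ p ∈ T.Λ5, ∑ p' ∈ T.Λ5, fStrength T.ek u p * T.σloc p p' * fStrength T.ek u p'

/-- The scalar quadratic form of (4.1), `⟨Λ₈^{(k−1)′}φ, Δ_{k,loc}(u_k)Λ₈^{(k−1)′}φ⟩ = Re Σ_{x,y ∈ Λ₈′} \overline{φ(x)} Δ_{k,loc}(u_k;x,y) φ(y)`.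
[cite: BalabanImbrieJaffe1988, (4.1) p.273] -/
def scalarForm (T : Term41 P k) (ukf : PBond P 0 → ℂ) (φ : Balaban1983to89.Site P k → ℂ) : ℝ :=
  (∑ x ∈ T.Λ8, ∑ y ∈ T.Λ8, (starRingEnd ℂ) (φ x) * T.Δloc ukf x y * φ y).re

/-- **(4.1)**, the term density `ρ′_k(u,φ,{X_ω},{u^{(j)}}) = χ_{k,Λ₀^{(k−1)′}} Π_ω g_k(X_ω) Π_σ F_{k,loc}(X_σ)
Π_{j=0}^{k−1}[Z^{(j)}_{Λ₁₀^{c*c}} Z^{(j)}_{Λ₁₀}(u_k)] × exp[−½⟨Λ₅′**f^{(k)}, σ_{k,loc}Λ₅′**f^{(k)}⟩ − ½⟨Λ₈′φ, Δ_{k,loc}(u_k)Λ₈′φ⟩ −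
𝒫_{k,loc}(Λ₈) − ℰ_k]` (p. 273 [PDF 17], verbatim in the module docstring), as a ℂ-valued function of the previous fields `prev`,
the unit-lattice gauge field `u` and scalar field `φ`. [cite: BalabanImbrieJaffe1988, (4.1) p.273] -/
def rhoPrime (T : Term41 P k) (prev : Prev P k) (u : PBond P k → ℂ) (φ : Balaban1983to89.Site P k → ℂ) : ℂ :=
  ((T.chi prev u φ * (∏ ω, T.g ω prev u φ) * (∏ j, T.Zv j * T.Zs j (T.uk prev u)) *
      Real.exp (-(1 / 2 : ℝ) * gaugeForm T u - (1 / 2 : ℝ) * scalarForm T (T.uk prev u) φ - T.Ploc prev u φ - T.calE) : ℝ) : ℂ) *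
    ∏ σ, T.Floc σ prev u φ

/-- **(4.1)**, the k-step density `ρ_k(u,φ) = Σ_{{X_ω}} ∫ Π_{j=0}^{k−1}[𝒟u^{(j)}|_{Λ₁₀^{(j)c*}}] ρ′_k(u,φ,{X_ω},{u^{(j)})`: the finite
sum over the terms (choices of `{X_ω}`, index set `terms`) of the fluctuation-field integrals of `ρ′_k` against the product of
normalized Haar measures. [cite: BalabanImbrieJaffe1988, (4.1) p.273] -/
def rho {ι : Type*} (terms : Finset ι) (T : ι → Term41 P k) (u : PBond P k → ℂ) (φ : Balaban1983to89.Site P k → ℂ) : ℂ :=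
  ∑ t ∈ terms, ∫ prev, rhoPrime (T t) prev u φ ∂(prevMeasure P k)

/-- p. 274 [PDF 18], verbatim: *"If we integrate this density over the u, φ variables, we obtain our original unnormalized
expectation [F]."* — the representation property of (4.1): `∫𝒟u𝒟φ ρ_k(u,φ) = [F]`, `[F]` = `BIJ88Sect3Statements.bracket S F`
((3.1), on the η-lattice = level 0, action `S`, observable `F`), `𝒟u` = `fieldMeasure` on the unit lattice (level k), `𝒟φ` =
Lebesgue measure on `ℂ^{sites}`, `u` read through `BIJ88Sect3Statements.cfg`. [cite: BalabanImbrieJaffe1988, (4.1) p.274] -/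
def Represents41 {ι : Type*} (terms : Finset ι) (T : ι → Term41 P k)
    (S : GaugeField P 0 U1 → (Balaban1983to89.Site P 0 → ℂ) → ℝ) (F : GaugeField P 0 U1 → (Balaban1983to89.Site P 0 → ℂ) → ℂ) :
    Prop :=
  ∫ U, (∫ φ : Balaban1983to89.Site P k → ℂ, rho terms T (BIJ88Sect3Statements.cfg U) φ) ∂(fieldMeasure P k U1) =
    BIJ88Sect3Statements.bracket S F

/-- **(3.44)** p. 273 [PDF 17], verbatim: *"ρ₁(v,ψ) = Σ_{{X_ω}} ∫𝒟u^{(0)}_{Λ₁₀^{c*}} χ_{1,Λ₀′} Π_ω g₁(X_ω) Π_σ F_{1,loc}(X_σ) Z_{Λ₁₀^{c*c}}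
Z_{Λ₁₀}(u₁) × exp[−½⟨Λ₅′**f^{(1)}, σ_{1,loc}Λ₅′**f^{(1)}⟩ − ½⟨Λ₈′ψ, Δ_{1,loc}(u₁)Λ₈′ψ⟩ − 𝒫_{1,loc}(Λ₈) − ℰ₁], (3.44) where
f^{(1)}(p) = (ie₁)⁻¹log v(p). We have described this expression in some detail, as it is the model for our starting point for the
general step."* — the first-step density IS (4.1) at `k = 1` (one fluctuation field `u^{(0)}`, one pair of `Z`-factors).
[cite: BalabanImbrieJaffe1988, (3.44) p.273] -/
abbrev rho1 {ι : Type*} (terms : Finset ι) (T : ι → Term41 P 1) (v : PBond P 1 → ℂ) (ψ : Balaban1983to89.Site P 1 → ℂ) : ℂ :=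
  rho terms T v ψ

/-! ## Elementary API -/

/-- A term of (4.1) vanishes off the support of the small-field characteristic function `χ_{k,Λ₀^{(k−1)′}}`.
[cite: BalabanImbrieJaffe1988, (4.1) p.273] -/
theorem rhoPrime_eq_zero_of_chi (T : Term41 P k) {prev : Prev P k} {u : PBond P k → ℂ} {φ : Balaban1983to89.Site P k → ℂ}
    (h : T.chi prev u φ = 0) : rhoPrime T prev u φ = 0 := by
  simp [rhoPrime, h]

/-- `χ_{k,Λ₀′} ∈ {0,1}` with value `1`: the characteristic function drops out of the term.
[cite: BalabanImbrieJaffe1988, (4.1) p.273] -/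
theorem rhoPrime_of_chi_one (T : Term41 P k) {prev : Prev P k} {u : PBond P k → ℂ} {φ : Balaban1983to89.Site P k → ℂ}
    (h : T.chi prev u φ = 1) :
    rhoPrime T prev u φ = (((∏ ω, T.g ω prev u φ) * (∏ j, T.Zv j * T.Zs j (T.uk prev u)) *
      Real.exp (-(1 / 2 : ℝ) * gaugeForm T u - (1 / 2 : ℝ) * scalarForm T (T.uk prev u) φ - T.Ploc prev u φ - T.calE) : ℝ) : ℂ) *
      ∏ σ, T.Floc σ prev u φ := by
  simp [rhoPrime, h]

/-- `ρ_k` of the empty set of terms is `0`. [cite: BalabanImbrieJaffe1988, (4.1) p.273] -/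
theorem rho_empty {ι : Type*} (T : ι → Term41 P k) (u : PBond P k → ℂ) (φ : Balaban1983to89.Site P k → ℂ) :
    rho ∅ T u φ = 0 := by
  simp [rho]

/-- `ρ_k` is additive in the set of terms `{X_ω}` (disjoint union of term sets). [cite: BalabanImbrieJaffe1988, (4.1) p.273] -/
theorem rho_union {ι : Type*} [DecidableEq ι] {s t : Finset ι} (h : Disjoint s t) (T : ι → Term41 P k) (u : PBond P k → ℂ)
    (φ : Balaban1983to89.Site P k → ℂ) : rho (s ∪ t) T u φ = rho s T u φ + rho t T u φ := by
  simp only [rho, Finset.sum_union h]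

/-- The product of normalized Haar measures `Π_j 𝒟u^{(j)}` is a probability measure (*"∫du^{(j)} = 1"*, p. 274).
[cite: BalabanImbrieJaffe1988, (4.1) p.274] -/
instance prevMeasure_isProbabilityMeasure (P : Params) (k : ℕ) : IsProbabilityMeasure (prevMeasure P k) := by
  unfold prevMeasure
  infer_instance

/-- Consequently a term whose density `ρ′_k` does not depend on the previous fields integrates to itself.
[cite: BalabanImbrieJaffe1988, (4.1) p.274] -/
theorem integral_rhoPrime_const (c : ℂ) : ∫ _prev : Prev P k, c ∂(prevMeasure P k) = c := by
  simp [integral_const]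

end

end Literature.MathematicalPhysics.QuantumFieldTheory.BalabanImbrieJaffe1984to88.BIJ88InductiveForm41
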